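import Mathlib.Analysis.SpecificLimits.Basic
import Mathlib.Topology.Algebra.InfiniteSum.Real
import Mathlib.Data.Matrix.Mul
import Mathlib.Data.Matrix.Basic
import HarnessLib

/-!
# Neumann series of a monotone family of non-negative matrices: a first-order bound at the end of the interval of convergence

Topic `Literature/Analysis/Matrix`.  Source of the method: E. Seneta, *Non-negative Matrices. An Introduction to Theory and
Applications* (Allen & Unwin / Wiley, 1973), Chapter 6 "R-theory" — §6.1 Theorem 6.1 and its proof (the inequalities
`t_{ij}^{(ν+k)} ≥ t_{ij}^{(ν)} t_{jj}^{(k)}` etc. spreading convergence of `Σ_k t_{ij}^{(k)} z^k` from one pair of indices to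
all pairs of an irreducible non-negative matrix; Corollary `R^k t_{ii}^{(k)} ≤ 1`), and §5.4 / §6.2 Definition 6.5, Theorem 6.3
(sub-invariant vectors `β T u ≤ u` of an irreducible non-negative matrix are positive, and none exists beyond the convergence
parameter).  Scalar case: W. Feller, *An Introduction to Probability Theory and its Applications* II (1971), XIV §1 (renewal
equation `U = 1/(1 − F)`).  Motivation (lane «pcv-sawmu», a-p2 g16 `MATHS-NOTE-k1-renewal.md`): the generating matrix `I(y)` of
irreducible horizontal bridges of the width-`T` honeycomb strip, indexed by entry/exit level, is entrywise a power series in the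
surface fugacity `y` with non-negative coefficients; the bridge series is `Σ_k I(y)^k`; the lemma below turns "finite below `y_T`"
into "at most `C/(y_T − y)`", with no spectral theory.

## What is proved (namespace `Literature.Analysis.Matrix`; `ι` finite, matrices `ι × ι` over `ℝ`)

Entrywise tools for non-negative matrices: `nonnegMat_pow_apply_nonneg`, `nonnegMat_pow_apply_mono` (powers are monotone in the entries),
`nonnegMat_mul_pow_apply_le_pow_add_apply` (`(A^p)_{ab} (A^q)_{bc} ≤ (A^{p+q})_{ac}`), monotonicity of `A *ᵥ ·`.

* `nonnegMat_summable_pow_apply_of_irreducible` — if the partial sums of `Σ_k (A^k)_{a₀b₀}` are bounded for ONE pair and `A ≥ A₀ ≥ 0`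
  with `A₀` irreducible, then `Σ_k (A^k)_{ab}` is summable for EVERY pair (Seneta's Theorem 6.1 argument);
* ★ **`nonnegMat_exists_partialSum_pow_apply_le_div`** — let `y ↦ I(y)` be entrywise non-negative and non-decreasing on `[y₀, R)`,
  `I(y₀)` irreducible, ONE entry increasing with slope `≥ δ > 0`, and `Σ_k (I(y)^k)_{a₀b₀}` with bounded partial sums for every
  `y ∈ [y₀, R)`.  Then there is `C` with `(Σ_{k<n} I(y)^k)_{ab} ≤ C / (R − y)` for all `y ∈ [y₀, R)`, `n`, `a`, `b`.
  Proof: for `y' ≤ y < R` the vector `s := Σ_k I(y)^k 𝟙` satisfies `I(y) s = s − 𝟙 ≤ s`, hence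
  `I(y') s ≤ s − (I(y) − I(y')) s`; telescoping gives `(Σ_{k<n} I(y')^k) (I(y) − I(y')) s ≤ s`; irreducibility bounds the ratios
  `s_a / s_b` uniformly; the distinguished entry contributes `δ (y − y') s_{b₁}`; finally `y ↑ R`.

Label: consolidation of textbook R-theory in the one consequence the lane needs; nothing new is claimed.  Lane «pcv-sawmu»,
a-p2 g16, 2026-08-24.

EDITION 2 (a-p2 g16): = edition 1 (3708d60bc0fcdfd6) code verbatim; three citation locators corrected after the lane referee's
AS-PRINTED cell (token RP-1): Seneta's Definition 6.5 / Theorem 6.3 are in §6.2 (not §6.1); Feller's renewal equation is XIV §1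
(vol. II, p. 466), not XIII.
-/

noncomputable section

open Finset Filter Matrix
open scoped Topology

namespace Literature.Analysis.Matrix

variable {ι : Type*} [Fintype ι] [DecidableEq ι]

/-! ### Entrywise order tools for non-negative matrices -/

section Tools

variable {A B : Matrix ι ι ℝ}

/-- Powers of an entrywise non-negative matrix are entrywise non-negative. [cite: Seneta1973, §1.1 and §6.1 (non-negative matrices and their powers)] -/
theorem nonnegMat_pow_apply_nonneg (hA : ∀ a b, 0 ≤ A a b) (k : ℕ) (a b : ι) : 0 ≤ (A ^ k) a b := by
  induction k generalizing a b with
  | zero =>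
    rw [pow_zero, Matrix.one_apply]
    split_ifs <;> norm_num
  | succ k ih =>
    rw [pow_succ, Matrix.mul_apply]
    exact Finset.sum_nonneg fun c _ => mul_nonneg (ih a c) (hA c b)

/-- Powers are monotone in the entries: `0 ≤ A ≤ B` entrywise implies `A^k ≤ B^k` entrywise. [cite: Seneta1973, §6.1 (proof of Theorem 6.1)] -/
theorem nonnegMat_pow_apply_mono (hA : ∀ a b, 0 ≤ A a b) (hAB : ∀ a b, A a b ≤ B a b) (k : ℕ) (a b : ι) :
    (A ^ k) a b ≤ (B ^ k) a b := by
  induction k generalizing a b with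
  | zero => rw [pow_zero, pow_zero]
  | succ k ih =>
    rw [pow_succ, pow_succ, Matrix.mul_apply, Matrix.mul_apply]
    exact Finset.sum_le_sum fun c _ => mul_le_mul (ih a c) (hAB c b) (hA c b)
      (nonnegMat_pow_apply_nonneg (fun a b => (hA a b).trans (hAB a b)) k a c)

/-- `(A^p)_{ab} (A^q)_{bc} ≤ (A^{p+q})_{ac}` for a non-negative matrix (one term of the matrix product).
[cite: Seneta1973, §6.1 proof of Theorem 6.1 ("the obvious inequalities t_{ij}^{(ν+k)} ≥ t_{ij}^{(ν)} t_{jj}^{(k)} …")] -/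
theorem nonnegMat_mul_pow_apply_le_pow_add_apply (hA : ∀ a b, 0 ≤ A a b) (p q : ℕ) (a b c : ι) :
    (A ^ p) a b * (A ^ q) b c ≤ (A ^ (p + q)) a c := by
  rw [pow_add, Matrix.mul_apply]
  exact Finset.single_le_sum (f := fun d => (A ^ p) a d * (A ^ q) d c)
    (fun d _ => mul_nonneg (nonnegMat_pow_apply_nonneg hA p a d) (nonnegMat_pow_apply_nonneg hA q d c)) (Finset.mem_univ b)

/-- A diagonal entry of a power dominates the power of the diagonal entry's cycle: `((A^p)_{ab} (A^q)_{ba})^n ≤ (A^{(p+q) n})_{aa}`.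
[cite: Seneta1973, §6.1 proof of Theorem 6.1 (t_{ii}^{(ν+k)} ≥ t_{ij}^{(ν)} t_{ji}^{(k)}) and Corollary] -/
theorem nonnegMat_pow_mul_pow_apply_le (hA : ∀ a b, 0 ≤ A a b) (p q : ℕ) (a b : ι) (n : ℕ) :
    ((A ^ p) a b * (A ^ q) b a) ^ n ≤ (A ^ ((p + q) * n)) a a := by
  induction n with
  | zero => simp
  | succ n ih =>
    have h1 : (A ^ p) a b * (A ^ q) b a ≤ (A ^ (p + q)) a a := nonnegMat_mul_pow_apply_le_pow_add_apply hA p q a b a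
    have h0 : 0 ≤ (A ^ p) a b * (A ^ q) b a := mul_nonneg (nonnegMat_pow_apply_nonneg hA p a b) (nonnegMat_pow_apply_nonneg hA q b a)
    calc ((A ^ p) a b * (A ^ q) b a) ^ (n + 1)
        = ((A ^ p) a b * (A ^ q) b a) ^ n * ((A ^ p) a b * (A ^ q) b a) := pow_succ _ _
      _ ≤ (A ^ ((p + q) * n)) a a * (A ^ (p + q)) a a :=
          mul_le_mul ih h1 h0 (nonnegMat_pow_apply_nonneg hA _ a a)
      _ ≤ (A ^ ((p + q) * n + (p + q))) a a := nonnegMat_mul_pow_apply_le_pow_add_apply hA _ _ a a a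
      _ = (A ^ ((p + q) * (n + 1))) a a := by rw [Nat.mul_succ]

omit [DecidableEq ι] in
/-- `A *ᵥ ·` is monotone for an entrywise non-negative matrix. [cite: Seneta1973, §5.4 (sub-invariant vectors)] -/
theorem nonnegMat_mulVec_le_mulVec_of_le (hA : ∀ a b, 0 ≤ A a b) {u v : ι → ℝ} (huv : u ≤ v) : A *ᵥ u ≤ A *ᵥ v := by
  intro a
  simp only [Matrix.mulVec, dotProduct]
  exact Finset.sum_le_sum fun b _ => mul_le_mul_of_nonneg_left (huv b) (hA a b)

omit [DecidableEq ι] in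
/-- `A ≤ B` entrywise and `v ≥ 0` give `A *ᵥ v ≤ B *ᵥ v`. [cite: Seneta1973, §5.4 (sub-invariant vectors)] -/
theorem nonnegMat_mulVec_le_mulVec_of_entry_le (hAB : ∀ a b, A a b ≤ B a b) {v : ι → ℝ} (hv : 0 ≤ v) : A *ᵥ v ≤ B *ᵥ v := by
  intro a
  simp only [Matrix.mulVec, dotProduct]
  exact Finset.sum_le_sum fun b _ => mul_le_mul_of_nonneg_right (hAB a b) (hv b)

omit [DecidableEq ι] in
/-- `A *ᵥ v ≥ 0` for `A, v ≥ 0`. [cite: Seneta1973, §5.4] -/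
theorem nonnegMat_mulVec_nonneg_of_nonneg (hA : ∀ a b, 0 ≤ A a b) {v : ι → ℝ} (hv : 0 ≤ v) : 0 ≤ A *ᵥ v := by
  intro a
  simp only [Matrix.mulVec, dotProduct, Pi.zero_apply]
  exact Finset.sum_nonneg fun b _ => mul_nonneg (hA a b) (hv b)

omit [DecidableEq ι] in
/-- One term of `A *ᵥ v` is below the sum (non-negative data). [cite: Seneta1973, §5.4] -/
theorem nonnegMat_apply_mul_le_mulVec (hA : ∀ a b, 0 ≤ A a b) {v : ι → ℝ} (hv : 0 ≤ v) (a b : ι) : A a b * v b ≤ (A *ᵥ v) a := by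
  simp only [Matrix.mulVec, dotProduct]
  exact Finset.single_le_sum (f := fun c => A a c * v c) (fun c _ => mul_nonneg (hA a c) (hv c)) (Finset.mem_univ b)

/-- Partial sums of the Neumann series: `Σ_{k<n+1} A^k = 1 + A (Σ_{k<n} A^k)`. [cite: Seneta1973, §6.1 (the series Σ_k T^k z^k)] -/
theorem nonnegMat_sum_range_succ_pow_eq (A : Matrix ι ι ℝ) (n : ℕ) :
    ∑ k ∈ range (n + 1), A ^ k = 1 + A * ∑ k ∈ range n, A ^ k := by
  rw [Finset.sum_range_succ', pow_zero, add_comm, Finset.mul_sum]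
  simp_rw [pow_succ']

/-- The entries of the partial sums are non-negative and dominate the identity. [cite: Seneta1973, §6.1] -/
theorem nonnegMat_sum_range_pow_apply_nonneg (hA : ∀ a b, 0 ≤ A a b) (n : ℕ) (a b : ι) :
    0 ≤ (∑ k ∈ range n, A ^ k) a b := by
  rw [Matrix.sum_apply]
  exact Finset.sum_nonneg fun k _ => nonnegMat_pow_apply_nonneg hA k a b

/-- Partial sums are monotone in `n` entrywise. [cite: Seneta1973, §6.1] -/
theorem nonnegMat_sum_range_pow_apply_mono (hA : ∀ a b, 0 ≤ A a b) {m n : ℕ} (hmn : m ≤ n) (a b : ι) :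
    (∑ k ∈ range m, A ^ k) a b ≤ (∑ k ∈ range n, A ^ k) a b := by
  rw [Matrix.sum_apply, Matrix.sum_apply]
  exact Finset.sum_le_sum_of_subset_of_nonneg (Finset.range_mono hmn) fun k _ _ => nonnegMat_pow_apply_nonneg hA k a b

/-- `(Σ_{k<n} A^k)_{ab} (A^j)_{bc} ≤ (Σ_{k<n+j} A^k)_{ac}`. [cite: Seneta1973, §6.1 proof of Theorem 6.1] -/
theorem nonnegMat_sum_range_pow_apply_mul_pow_apply_le (hA : ∀ a b, 0 ≤ A a b) (n j : ℕ) (a b c : ι) :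
    (∑ k ∈ range n, A ^ k) a b * (A ^ j) b c ≤ (∑ k ∈ range (n + j), A ^ k) a c := by
  rw [Matrix.sum_apply, Matrix.sum_apply, Finset.sum_mul]
  calc ∑ k ∈ range n, (A ^ k) a b * (A ^ j) b c
      ≤ ∑ k ∈ range n, (A ^ (k + j)) a c := Finset.sum_le_sum fun k _ => nonnegMat_mul_pow_apply_le_pow_add_apply hA k j a b c
    _ = ∑ k ∈ (range n).map (addRightEmbedding j), (A ^ k) a c := by rw [Finset.sum_map]; rfl
    _ ≤ ∑ k ∈ range (n + j), (A ^ k) a c := by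
        refine Finset.sum_le_sum_of_subset_of_nonneg (fun k hk => ?_) fun k _ _ => nonnegMat_pow_apply_nonneg hA k a c
        obtain ⟨i, hi, rfl⟩ := Finset.mem_map.1 hk
        simp only [addRightEmbedding_apply, Finset.mem_range] at hi ⊢
        omega

end Tools

/-! ### From one pair of indices to all pairs (irreducibility) -/

section Irreducible

variable {A₀ A : Matrix ι ι ℝ}

/-- **Seneta's Theorem 6.1 argument.** If `0 ≤ A₀ ≤ A` entrywise, `A₀` is irreducible (`∀ a b ∃ j, (A₀^j)_{ab} > 0`), and the
partial sums of `Σ_k (A^k)_{a₀b₀}` are bounded for one pair `(a₀, b₀)`, then they are bounded for every pair.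
[cite: Seneta1973, §6.1 Theorem 6.1 (common convergence radius of Σ_k t_{ij}^{(k)} z^k for irreducible T)] -/
theorem nonnegMat_exists_partialSum_pow_apply_le_of_irreducible (h0 : ∀ a b, 0 ≤ A₀ a b) (hle : ∀ a b, A₀ a b ≤ A a b)
    (hirr : ∀ a b, ∃ j, 0 < (A₀ ^ j) a b) {a₀ b₀ : ι} {B : ℝ}
    (hB : ∀ n, (∑ k ∈ range n, A ^ k) a₀ b₀ ≤ B) (a b : ι) :
    ∃ B', ∀ n, (∑ k ∈ range n, A ^ k) a b ≤ B' := by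
  have hA : ∀ a b, 0 ≤ A a b := fun a b => (h0 a b).trans (hle a b)
  obtain ⟨i, hi⟩ := hirr a₀ a
  obtain ⟨j, hj⟩ := hirr b b₀
  have hi' : 0 < (A ^ i) a₀ a := hi.trans_le (nonnegMat_pow_apply_mono h0 hle i a₀ a)
  have hj' : 0 < (A ^ j) b b₀ := hj.trans_le (nonnegMat_pow_apply_mono h0 hle j b b₀)
  refine ⟨B / ((A ^ i) a₀ a * (A ^ j) b b₀), fun n => ?_⟩
  rw [le_div_iff₀ (mul_pos hi' hj')]
  -- `(A^i)_{a₀a} (Σ_{k<n} A^k)_{ab} (A^j)_{bb₀} ≤ (Σ_{k<i+n+j} A^k)_{a₀b₀} ≤ B`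
  have h1 : ∀ k, (A ^ i) a₀ a * (A ^ k) a b * (A ^ j) b b₀ ≤ (A ^ (i + k + j)) a₀ b₀ := fun k =>
    (mul_le_mul_of_nonneg_right (nonnegMat_mul_pow_apply_le_pow_add_apply hA i k a₀ a b) (nonnegMat_pow_apply_nonneg hA j b b₀)).trans
      (nonnegMat_mul_pow_apply_le_pow_add_apply hA (i + k) j a₀ b b₀)
  calc (∑ k ∈ range n, A ^ k) a b * ((A ^ i) a₀ a * (A ^ j) b b₀)
      = ∑ k ∈ range n, (A ^ i) a₀ a * (A ^ k) a b * (A ^ j) b b₀ := by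
        rw [Matrix.sum_apply, Finset.sum_mul]; exact Finset.sum_congr rfl fun k _ => by ring
    _ ≤ ∑ k ∈ range n, (A ^ (i + k + j)) a₀ b₀ := Finset.sum_le_sum fun k _ => h1 k
    _ = ∑ k ∈ (range n).map (addLeftEmbedding i |>.trans (addRightEmbedding j)), (A ^ k) a₀ b₀ := by
        rw [Finset.sum_map]; rfl
    _ ≤ (∑ k ∈ range (i + n + j), A ^ k) a₀ b₀ := by
        rw [Matrix.sum_apply]
        refine Finset.sum_le_sum_of_subset_of_nonneg (fun k hk => ?_) fun k _ _ => nonnegMat_pow_apply_nonneg hA k a₀ b₀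
        obtain ⟨m, hm, rfl⟩ := Finset.mem_map.1 hk
        simp only [Finset.mem_range, Function.Embedding.trans_apply, addLeftEmbedding_apply,
          addRightEmbedding_apply] at hm ⊢
        omega
    _ ≤ B := hB _

/-- Under the same hypotheses every entry series `Σ_k (A^k)_{ab}` is summable, so `(A^k)_{ab} → 0`.
[cite: Seneta1973, §6.1 Theorem 6.1] -/
theorem nonnegMat_summable_pow_apply_of_irreducible (h0 : ∀ a b, 0 ≤ A₀ a b) (hle : ∀ a b, A₀ a b ≤ A a b)
    (hirr : ∀ a b, ∃ j, 0 < (A₀ ^ j) a b) {a₀ b₀ : ι} {B : ℝ}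
    (hB : ∀ n, (∑ k ∈ range n, A ^ k) a₀ b₀ ≤ B) (a b : ι) :
    Summable fun k => (A ^ k) a b := by
  obtain ⟨B', hB'⟩ := nonnegMat_exists_partialSum_pow_apply_le_of_irreducible h0 hle hirr hB a b
  refine summable_of_sum_range_le (fun k => nonnegMat_pow_apply_nonneg (fun a b => (h0 a b).trans (hle a b)) k a b) (c := B') ?_
  intro n
  rw [← Matrix.sum_apply]
  exact hB' n

end Irreducible

/-! ### The sub-invariant vector `s = Σ_k A^k 𝟙` -/

section SubInvariant

variable {A : Matrix ι ι ℝ}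

/-- If every `Σ_k (A^k)_{ab}` is summable (`A ≥ 0`), the vector `s_a := Σ_b Σ_k (A^k)_{ab}` is `≥ 𝟙` and satisfies
`A s = s − 𝟙`, in particular `A s ≤ s` (a sub-invariant vector). [cite: Seneta1973, §5.4 and §6.2 (Definition 6.5, Theorem 6.3: sub-invariant vectors from the resolvent series)] -/
theorem nonnegMat_exists_subInvariant_vector (hA : ∀ a b, 0 ≤ A a b) (hsum : ∀ a b, Summable fun k => (A ^ k) a b) :
    ∃ s : ι → ℝ, (∀ a, 1 ≤ s a) ∧ A *ᵥ s ≤ s ∧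
      ∀ a b, ∑' k, (A ^ k) a b ≤ s a := by
  refine ⟨fun a => ∑ b, ∑' k, (A ^ k) a b, fun a => ?_, fun a => ?_, fun a b => ?_⟩
  · -- `s_a ≥ Σ'_k (A^k)_{aa} ≥ (A^0)_{aa} = 1`
    have h1 : (1 : ℝ) ≤ ∑' k, (A ^ k) a a := by
      have := (hsum a a).le_tsum 0 (fun k _ => nonnegMat_pow_apply_nonneg hA k a a)
      simpa [Matrix.one_apply] using this
    exact h1.trans (Finset.single_le_sum (f := fun b => ∑' k, (A ^ k) a b)
      (fun b _ => tsum_nonneg fun k => nonnegMat_pow_apply_nonneg hA k a b) (Finset.mem_univ a))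
  · -- `(A s)_a = Σ_b Σ'_k (A^{k+1})_{ab} = s_a − 1 ≤ s_a`
    simp only [Matrix.mulVec, dotProduct]
    have hshift : ∀ b, ∑' k, (A ^ (k + 1)) a b = (∑' k, (A ^ k) a b) - (A ^ 0) a b := fun b => by
      rw [(hsum a b).tsum_eq_zero_add]; ring
    have hsum1 : ∀ b, Summable fun k => (A ^ (k + 1)) a b := fun b => (summable_nat_add_iff 1).2 (hsum a b)
    calc ∑ c, A a c * ∑ b, ∑' k, (A ^ k) c b
        = ∑ b, ∑ c, A a c * ∑' k, (A ^ k) c b := by rw [Finset.sum_comm]; simp_rw [Finset.mul_sum]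
      _ = ∑ b, ∑' k, ∑ c, A a c * (A ^ k) c b := by
          refine Finset.sum_congr rfl fun b _ => ?_
          simp_rw [← tsum_mul_left]
          exact (Summable.tsum_finsetSum fun c _ => (hsum c b).mul_left (A a c)).symm
      _ = ∑ b, ∑' k, (A ^ (k + 1)) a b := by
          refine Finset.sum_congr rfl fun b _ => tsum_congr fun k => ?_
          rw [pow_succ', Matrix.mul_apply]
      _ = ∑ b, ((∑' k, (A ^ k) a b) - (A ^ 0) a b) := Finset.sum_congr rfl fun b _ => hshift b
      _ = (∑ b, ∑' k, (A ^ k) a b) - 1 := by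
          rw [Finset.sum_sub_distrib, pow_zero]
          simp [Matrix.one_apply]
      _ ≤ ∑ b, ∑' k, (A ^ k) a b := by linarith
  · exact Finset.single_le_sum (f := fun b => ∑' k, (A ^ k) a b)
      (fun b _ => tsum_nonneg fun k => nonnegMat_pow_apply_nonneg hA k a b) (Finset.mem_univ b)

/-- **Telescoping.** If `A' ≥ 0` entrywise and `A s ≤ s`, then for every `n`:
`(Σ_{k<n} A'^k) ((A − A') s) + A'^n s ≤ s`. [cite: Seneta1973, §6.2 Theorem 6.3 (β-sub-invariance and the resolvent); lane form] -/
theorem nonnegMat_sum_range_pow_mulVec_sub_le {A A' : Matrix ι ι ℝ} (hA' : ∀ a b, 0 ≤ A' a b)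
    {s : ι → ℝ} (hAs : A *ᵥ s ≤ s) (n : ℕ) :
    (∑ k ∈ range n, A' ^ k) *ᵥ ((A - A') *ᵥ s) + (A' ^ n) *ᵥ s ≤ s := by
  induction n with
  | zero => simp
  | succ n ih =>
    -- apply `A'` to the induction hypothesis
    have h1 : A' *ᵥ ((∑ k ∈ range n, A' ^ k) *ᵥ ((A - A') *ᵥ s) + (A' ^ n) *ᵥ s) ≤ A' *ᵥ s :=
      nonnegMat_mulVec_le_mulVec_of_le hA' ih
    have h2 : A' *ᵥ s = A *ᵥ s - (A - A') *ᵥ s := by rw [Matrix.sub_mulVec]; abel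
    have h3 : (∑ k ∈ range (n + 1), A' ^ k) *ᵥ ((A - A') *ᵥ s) + (A' ^ (n + 1)) *ᵥ s
        = (A - A') *ᵥ s + A' *ᵥ ((∑ k ∈ range n, A' ^ k) *ᵥ ((A - A') *ᵥ s) + (A' ^ n) *ᵥ s) := by
      rw [Matrix.mulVec_add, Matrix.mulVec_mulVec ((A - A') *ᵥ s) A' (∑ k ∈ range n, A' ^ k),
        Matrix.mulVec_mulVec s A' (A' ^ n), ← pow_succ', nonnegMat_sum_range_succ_pow_eq, Matrix.add_mulVec, Matrix.one_mulVec,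
        add_assoc]
    rw [h3]
    intro a
    have := h1 a
    have h4 := hAs a
    simp only [Pi.add_apply, Pi.sub_apply, h2] at this h4 ⊢
    linarith

end SubInvariant

/-! ### The first-order bound -/

/-- ★ **First-order bound for the Neumann series of a monotone family of non-negative matrices.**  Let `I : ℝ → Matrix ι ι ℝ` be
entrywise non-negative and non-decreasing on `[y₀, R)`, with `I(y₀)` irreducible, one entry `(a₁, b₁)` increasing with slope at
least `δ > 0`, and `Σ_k (I(y)^k)_{a₀b₀}` with bounded partial sums for every `y ∈ [y₀, R)`.  Then for some `C` and all
`y ∈ [y₀, R)`, `n`, `a`, `b`: `(Σ_{k<n} I(y)^k)_{ab} ≤ C / (R − y)`.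
[cite: Seneta1973, Chapter 6 (§6.1 Theorem 6.1 and §6.2 Theorem 6.3: convergence parameter, sub-invariant vectors); Feller1971, XIV §1 (p. 466: the renewal equation); lane lemma «RENEWAL-POLE» of MATHS-NOTE-k1-renewal] -/
theorem nonnegMat_exists_partialSum_pow_apply_le_div (I : ℝ → Matrix ι ι ℝ) {y₀ R δ : ℝ} (hδ : 0 < δ)
    (h0 : ∀ y ∈ Set.Ico y₀ R, ∀ a b, 0 ≤ I y a b)
    (hmono : ∀ ⦃y y'⦄, y ∈ Set.Ico y₀ R → y' ∈ Set.Ico y₀ R → y ≤ y' → ∀ a b, I y a b ≤ I y' a b)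
    (hirr : ∀ a b, ∃ j, 0 < (I y₀ ^ j) a b)
    {a₁ b₁ : ι} (hslope : ∀ ⦃y y'⦄, y ∈ Set.Ico y₀ R → y' ∈ Set.Ico y₀ R → y ≤ y' →
      δ * (y' - y) ≤ I y' a₁ b₁ - I y a₁ b₁)
    {a₀ b₀ : ι} (hbdd : ∀ y ∈ Set.Ico y₀ R, ∃ B, ∀ n, (∑ k ∈ range n, I y ^ k) a₀ b₀ ≤ B) :
    ∃ C : ℝ, ∀ y ∈ Set.Ico y₀ R, ∀ n a b, (∑ k ∈ range n, I y ^ k) a b ≤ C / (R - y) := by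
  classical
  by_cases hne : y₀ < R
  swap
  · exact ⟨0, fun y hy => absurd (hy.1.trans_lt hy.2) hne⟩
  have hy₀ : y₀ ∈ Set.Ico y₀ R := ⟨le_rfl, hne⟩
  have h00 : ∀ a b, 0 ≤ I y₀ a b := h0 y₀ hy₀
  -- a uniform positive constant below all the irreducibility witnesses we use
  choose jf hjf using hirr
  obtain ⟨c, hc, hcle⟩ : ∃ c : ℝ, 0 < c ∧ ∀ a b, c ≤ (I y₀ ^ jf a b) a b := by
    have hfin : (Set.range fun p : ι × ι => (I y₀ ^ jf p.1 p.2) p.1 p.2).Finite := Set.finite_range _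
    haveI : Nonempty (ι × ι) := ⟨(a₁, b₁)⟩
    have hne' : (Set.range fun p : ι × ι => (I y₀ ^ jf p.1 p.2) p.1 p.2).Nonempty := Set.range_nonempty _
    obtain ⟨c, hcmem, hcmin⟩ := Set.exists_min_image _ id hfin hne'
    obtain ⟨p, rfl⟩ := hcmem
    exact ⟨_, hjf p.1 p.2, fun a b => hcmin _ ⟨(a, b), rfl⟩⟩
  -- the bound for `y' < y < R`
  have key : ∀ y' ∈ Set.Ico y₀ R, ∀ y ∈ Set.Ico y₀ R, y' < y →
      ∀ n a b, (∑ k ∈ range n, I y' ^ k) a b ≤ 1 / (δ * c ^ 2 * (y - y')) := by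
    intro y' hy' y hy hlt n a b
    have hA : ∀ a b, 0 ≤ I y a b := h0 y hy
    have hA' : ∀ a b, 0 ≤ I y' a b := h0 y' hy'
    have hle0 : ∀ a b, I y₀ a b ≤ I y a b := hmono hy₀ hy hy.1
    have hle0' : ∀ a b, I y₀ a b ≤ I y' a b := hmono hy₀ hy' hy'.1
    have hle : ∀ a b, I y' a b ≤ I y a b := hmono hy' hy hlt.le
    -- summability of all entry series at `y`, the sub-invariant vector `s`
    obtain ⟨B, hB⟩ := hbdd y hy
    have hsum : ∀ a b, Summable fun k => (I y ^ k) a b := fun a b =>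
      nonnegMat_summable_pow_apply_of_irreducible h00 hle0 (fun a b => ⟨jf a b, hjf a b⟩) hB a b
    obtain ⟨s, hs1, hAs, -⟩ := nonnegMat_exists_subInvariant_vector hA hsum
    have hs0 : 0 ≤ s := fun a => zero_le_one.trans (hs1 a)
    -- ratios: `c * s_a ≤ s_{b'}` for all `a, b'` (from `I(y)^j s ≤ s` and irreducibility)
    have hpow_s : ∀ j, (I y ^ j) *ᵥ s ≤ s := by
      intro j
      induction j with
      | zero => simp
      | succ j ih =>
        rw [pow_succ', ← Matrix.mulVec_mulVec]
        exact (nonnegMat_mulVec_le_mulVec_of_le hA ih).trans hAs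
    have hratio : ∀ a b', c * s a ≤ s b' := by
      intro a b'
      have h1 : (I y ^ jf b' a) b' a * s a ≤ ((I y ^ jf b' a) *ᵥ s) b' :=
        nonnegMat_apply_mul_le_mulVec (nonnegMat_pow_apply_nonneg hA _) hs0 b' a
      have h2 : c ≤ (I y ^ jf b' a) b' a := (hcle b' a).trans (nonnegMat_pow_apply_mono h00 hle0 _ b' a)
      have h3 : ((I y ^ jf b' a) *ᵥ s) b' ≤ s b' := hpow_s (jf b' a) b'
      exact (mul_le_mul_of_nonneg_right h2 (hs0 a)).trans (h1.trans h3)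
    -- telescoping at `y'` against `s`
    have htel := nonnegMat_sum_range_pow_mulVec_sub_le hA' hAs
    -- `(Σ_{k<m} I(y')^k)_{a a₁} · δ (y - y') s_{b₁} ≤ s_a` for every `m`
    have hcol : ∀ m a, (∑ k ∈ range m, I y' ^ k) a a₁ * (δ * (y - y') * s b₁) ≤ s a := by
      intro m a
      have hD0 : ∀ a b, 0 ≤ (I y - I y') a b := fun a b => by rw [Matrix.sub_apply]; linarith [hle a b]
      have hDs0 : 0 ≤ (I y - I y') *ᵥ s := nonnegMat_mulVec_nonneg_of_nonneg hD0 hs0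
      have h1 : δ * (y - y') * s b₁ ≤ ((I y - I y') *ᵥ s) a₁ := by
        have := nonnegMat_apply_mul_le_mulVec hD0 hs0 a₁ b₁
        rw [Matrix.sub_apply] at this
        have h2 := hslope hy' hy hlt.le
        exact (mul_le_mul_of_nonneg_right h2 (hs0 b₁)).trans this
      have hP0 : ∀ a b, 0 ≤ (∑ k ∈ range m, I y' ^ k) a b := nonnegMat_sum_range_pow_apply_nonneg hA' m
      have h3 : (∑ k ∈ range m, I y' ^ k) a a₁ * ((I y - I y') *ᵥ s) a₁
          ≤ ((∑ k ∈ range m, I y' ^ k) *ᵥ ((I y - I y') *ᵥ s)) a := nonnegMat_apply_mul_le_mulVec hP0 hDs0 a a₁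
      have h4 : ((∑ k ∈ range m, I y' ^ k) *ᵥ ((I y - I y') *ᵥ s)) a ≤ s a := by
        have h5 := htel m a
        have h6 : 0 ≤ ((I y' ^ m) *ᵥ s) a := nonnegMat_mulVec_nonneg_of_nonneg (nonnegMat_pow_apply_nonneg hA' m) hs0 a
        simp only [Pi.add_apply] at h5
        linarith
      calc (∑ k ∈ range m, I y' ^ k) a a₁ * (δ * (y - y') * s b₁)
          ≤ (∑ k ∈ range m, I y' ^ k) a a₁ * ((I y - I y') *ᵥ s) a₁ := mul_le_mul_of_nonneg_left h1 (hP0 a a₁)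
        _ ≤ s a := h3.trans h4
    -- other columns through `(A₀^j)_{b a₁}`
    have hyy : 0 < y - y' := sub_pos.2 hlt
    have hsb : 0 < s b₁ := zero_lt_one.trans_le (hs1 b₁)
    have h7 : (∑ k ∈ range n, I y' ^ k) a b * c ≤ (∑ k ∈ range (n + jf b a₁), I y' ^ k) a a₁ := by
      have h8 := nonnegMat_sum_range_pow_apply_mul_pow_apply_le hA' n (jf b a₁) a b a₁
      have h9 : c ≤ (I y' ^ jf b a₁) b a₁ := (hcle b a₁).trans (nonnegMat_pow_apply_mono h00 hle0' _ b a₁)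
      exact (mul_le_mul_of_nonneg_left h9 (nonnegMat_sum_range_pow_apply_nonneg hA' n a b)).trans h8
    have h10 := hcol (n + jf b a₁) a
    have h11 := hratio a b₁
    -- combine: `P_{ab} c · δ (y−y') s_{b₁} ≤ s_a ≤ s_{b₁} / c`
    set P := (∑ k ∈ range n, I y' ^ k) a b with hP
    rw [le_div_iff₀ (by positivity)]
    have h12 : P * c * (δ * (y - y') * s b₁) ≤ s a :=
      (mul_le_mul_of_nonneg_right h7 (by positivity)).trans h10
    have h13 : P * c * (δ * (y - y') * s b₁) * c ≤ s b₁ := by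
      have := mul_le_mul_of_nonneg_right h12 hc.le
      linarith [h11, this]
    have h15 : P * (δ * c ^ 2 * (y - y')) * s b₁ ≤ 1 * s b₁ := by
      have : P * (δ * c ^ 2 * (y - y')) * s b₁ = P * c * (δ * (y - y') * s b₁) * c := by ring
      linarith
    exact le_of_mul_le_mul_right h15 hsb
  -- let `y ↑ R`
  refine ⟨1 / (δ * c ^ 2), fun y' hy' n a b => ?_⟩
  have hlim : Tendsto (fun y : ℝ => 1 / (δ * c ^ 2 * (y - y'))) (𝓝[<] R) (𝓝 (1 / (δ * c ^ 2 * (R - y')))) := by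
    have hcont : ContinuousAt (fun y : ℝ => 1 / (δ * c ^ 2 * (y - y'))) R := by
      have hne0 : δ * c ^ 2 * (R - y') ≠ 0 := by
        have := hy'.2; positivity
      exact ContinuousAt.div continuousAt_const (by fun_prop) hne0
    exact hcont.tendsto.mono_left nhdsWithin_le_nhds
  have hev : ∀ᶠ y in 𝓝[<] R, (∑ k ∈ range n, I y' ^ k) a b ≤ 1 / (δ * c ^ 2 * (y - y')) := by
    have hmem : Set.Ioo y' R ∈ 𝓝[<] R := Ioo_mem_nhdsLT hy'.2
    filter_upwards [hmem] with y hy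
    exact key y' hy' y ⟨hy'.1.trans hy.1.le, hy.2⟩ hy.1 n a b
  have := ge_of_tendsto hlim hev
  rw [div_div]
  exact this

end Literature.Analysis.Matrix

end
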